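import Mathlib
import Summits.QuantumFields.BalabanUV.Beta.AnalyticWalkSum216RowRegroup
import Summits.QuantumFields.BalabanUV.Beta.UnitLatticeDecoratedRowData

/-!
# [Balaban1988RG2Cluster] (1.6)–(1.8) p. 3 ∕ [Balaban1985BackgroundPropagators] (3.107)–(3.108) p. 416 — REGROUPING GLUE,
# PART 3: the TUBE-decorated unit-lattice family (`UnitLatticeDecoratedRowData.decFamily … (tubeDec cellOf E)` — the
# family in which co-owner d4-p2's `CovariantTowerRowData.rowData_tower_torus` inhabits interface item (I1)'s TYPE from a
# general transport U in the MODEL) DOMINATES its extremal decoration weight, so it regroups into the next layer's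
# (T3)-slot by `AnalyticWalkSum216RowRegroup.regroup_bound` (cell topic `Summits/QuantumFields/BalabanUV/Beta`; NODE A)

HONEST FRAMING (cell rule).  Discharging `BetaPertH` makes Bałaban's UV stability UNCONDITIONAL — a real constructive-QFT
result; NOT the continuum limit, NOT the Clay problem.  This module discharges NOTHING of `BetaPertH`.  [folklore]: the
one-line «constant-coefficient» reading of the co-owner's `rowData_decFamily(_tube).hm` argument (unit
`b2b-balaban-beta-d4-p3`, gen 3∕4), exactly as `AnalyticWalkSum216RowRegroupOmega.dominates_decFamilyΩ` (gen 38∕39) did for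
the Ω-family — INFO-1 of the owner's XREAD of `CovariantTowerRowData` p219735 (journal l.14831; C-an4-110): with it the
MODEL instance of (I1) composes with `regroup_bound` → `rowData_decPieces` → `rowData_pert` literally.  Nothing of
Bałaban's operators is instantiated; NO class change on any GAPS row; readiness width 0 unchanged; NOT summit progress.
Unit `b2b-balaban-beta-an4-g39` (owner lineage of `BINDER-OWNERS.md` row D4); `GAPS.md` C-an4-111.

CITATION HEADER (lean-in-tree rule).  [II] = T. Bałaban, *Renormalization group approach to lattice gauge field theories.
II. Cluster expansions*, Commun. Math. Phys. **116**, 1–22 (1988) [Balaban1988RG2Cluster], p. 3 (1.6)–(1.8); [13] =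
T. Bałaban, *Propagators for lattice gauge theories in a background field*, Commun. Math. Phys. **99**, 389–434 (1985)
[Balaban1985BackgroundPropagators], Thm 3.10 (3.107)–(3.108) p. 416.  LOCATORS only; nothing printed is asserted.

WHAT IS CERTIFIED HERE (kernel, sorry-free; [folklore]).
§1 **`dominates_decFamily`** — for ANY decoration rule `dec` with the tube bound `#dec n b⃗ ≤ c₀ + c₁·pathLen(y)` along
   admissible chains (the hypothesis `htube` of `rowData_decFamily`): `Dominates κ₁ (dec) (walkTerm) (decMaj e^{κ₁c₀} (κ₁c₁))`;
   **`dominates_decFamily_tube`** — the concrete tube decoration `tubeDec cellOf E` under packing (`card_tubeDec_le`):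
   `Dominates κ₁ (tubeDec …) (walkTerm …) (decMaj e^{κ₁P} (κ₁P∕r) …)` — the majorant of `rowData_decFamily_tube` and of
   d4-p2's `rowData_tower_torus`.
§2 Non-vacuity (one site, empty kernel).
NOT CLAIMED.  Any instance.  NOT summit progress.
PRIOR ART IN THE TREE (searched 2026-08-20): `AnalyticWalkSum216RowRegroupOmega.dominates_decFamilyΩ` and d4-p3
`UnitLatticeOmegaDominates.dominates_walkTermΩ(_cells)` (the Ω-family — not the tube family); d4-p3
`UnitLatticeDecoratedRowData.norm_coeff_mul_walkTerm_le`, `UnitLatticeTubeCount.card_tubeDec_le` (USED BY NAME).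
-/

namespace Summit.QuantumFields.BalabanUV.Beta.AnalyticWalkSum216RowRegroupTube

open Metric Set
open Literature.MathematicalPhysics.QuantumFieldTheory.Balaban1983to89
open B13PerturbativeStep (WeightHyp)
open Summit.QuantumFields.BalabanUV.Beta.AnalyticWalkSum216RowRegroup (Dominates)
open Summit.QuantumFields.BalabanUV.Beta.UnitLatticeTubeCount (pathLen pathLen_nonneg tubeDec card_tubeDec_le)
open Summit.QuantumFields.BalabanUV.Beta.UnitLatticeWalkTerms (walkTerm)
open Summit.QuantumFields.BalabanUV.Beta.UnitLatticeDecoratedPaths (walkMajP)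
open Summit.QuantumFields.BalabanUV.Beta.UnitLatticeDecoratedRowData (Walk decMaj norm_coeff_mul_walkTerm_le)

noncomputable section

variable {Y : Type*} [Fintype Y] [DecidableEq Y] {B Δ : Type*} [DecidableEq Δ] {d : Y → Y → ℝ}

/-! ## §1 The tube-decorated family dominates its extremal decoration weight -/

omit [DecidableEq Δ] in
/-- **`e^{κ₁·#dec(w)}·‖walkTerm_w(i,j)‖ ≤ decMaj (e^{κ₁c₀}) (κ₁c₁) … w (i,j)`** for ANY decoration rule with the tube bound
`#dec n b⃗ ≤ c₀ + c₁·pathLen(y)` along every admissible chain `y` of `b⃗` — the co-owner's `rowData_decFamily.hm`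
argument with the constant coefficient `e^{κ₁#dec}`. [cite: Balaban1985BackgroundPropagators, Thm 3.10 (3.108) p.416] -/
theorem dominates_decFamily (htri : ∀ a b c, d a c ≤ d a b + d b c) (hnn : ∀ a b, 0 ≤ d a b) (K' : Matrix Y Y ℂ)
    (h : B → Y → ℝ) (E : B → Finset Y) (L : B → Matrix Y Y ℂ) (hsupp : ∀ b y, y ∉ E b → h b y = 0)
    {κ₁ c₀ c₁ : ℝ} (hκ₁ : 0 ≤ κ₁) (hc₁ : 0 ≤ c₁) (dec : (n : ℕ) → (Fin (n + 1) → B) → Finset Δ)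
    (htube : ∀ (n : ℕ) (b : Fin (n + 1) → B) (y : Fin (n + 1) → Y), (∀ t, y t ∈ E (b t)) →
      ((dec n b).card : ℝ) ≤ c₀ + c₁ * pathLen d n y) :
    Dominates κ₁ (fun w : Walk B => dec w.1 w.2) (fun w => walkTerm h K' L w.1 w.2)
      (decMaj (Real.exp (κ₁ * c₀)) (κ₁ * c₁) d h K' L) := by
  intro w i j
  have hco : ‖((Real.exp (κ₁ * (dec w.1 w.2).card) : ℝ) : ℂ)‖ = Real.exp (κ₁ * (dec w.1 w.2).card) := by
    rw [Complex.norm_real, Real.norm_of_nonneg (Real.exp_pos _).le]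
  have h1 := norm_coeff_mul_walkTerm_le h E hsupp K' L (mul_nonneg hκ₁ hc₁) d hnn htri (Real.exp_pos (κ₁ * c₀)).le
    w.1 w.2 ((Real.exp (κ₁ * (dec w.1 w.2).card) : ℝ) : ℂ) (fun y hy => ?_) i j
  · rw [hco] at h1
    rw [decMaj]
    exact h1
  · rw [hco, ← Real.exp_add]
    refine Real.exp_le_exp.2 ?_
    have := mul_le_mul_of_nonneg_left (htube w.1 w.2 y hy) hκ₁
    calc κ₁ * ((dec w.1 w.2).card : ℝ) ≤ κ₁ * (c₀ + c₁ * pathLen d w.1 y) := this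
      _ = κ₁ * c₀ + κ₁ * c₁ * pathLen d w.1 y := by ring

/-- **The CONCRETE tube decoration** `tubeDec cellOf E` (all cells met by `⋃_t □̃_{b_t}`) under packing (`P` cells per ball
of radius `R ≥ r + D`, `D` = diameter of the `□̃_b`): `Dominates κ₁ (tubeDec …) (walkTerm …) (decMaj e^{κ₁P} (κ₁P∕r) …)` —
the majorant of `rowData_decFamily_tube` and of co-owner d4-p2's `CovariantTowerRowData.rowData_tower_torus`
(`card_tubeDec_le` BY NAME). [cite: Balaban1988RG2Cluster, (1.6)–(1.8) p.3] -/
theorem dominates_decFamily_tube (hw : WeightHyp (0 : ℝ) d) (K' : Matrix Y Y ℂ) (h : B → Y → ℝ) (E : B → Finset Y)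
    (L : B → Matrix Y Y ℂ) (hsupp : ∀ b y, y ∉ E b → h b y = 0) {κ₁ r D R : ℝ} (hκ₁ : 0 ≤ κ₁) (hr : 0 < r)
    (hRD : r + D ≤ R) (cellOf : Y → Δ) {P : ℕ}
    (hpack : ∀ a : Y, ∃ S : Finset Δ, S.card ≤ P ∧ ∀ z, d a z ≤ R → cellOf z ∈ S)
    (hdiam : ∀ b, ∀ z ∈ E b, ∀ z' ∈ E b, d z z' ≤ D) :
    Dominates κ₁ (fun w : Walk B => tubeDec cellOf E w.1 w.2) (fun w => walkTerm h K' L w.1 w.2)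
      (decMaj (Real.exp (κ₁ * P)) (κ₁ * (P / r)) d h K' L) :=
  dominates_decFamily hw.tri hw.nonneg K' h E L hsupp hκ₁ (div_nonneg (Nat.cast_nonneg P) hr.le) (tubeDec cellOf E)
    fun n b y hy => by
      calc ((tubeDec cellOf E n b).card : ℝ) ≤ P * (1 + pathLen d n y / r) :=
            card_tubeDec_le d hw.tri hw.zero hw.nonneg hr hRD cellOf hpack E hdiam b y hy
        _ = P + P / r * pathLen d n y := by ring

/-! ## §2 Non-vacuity -/

/-- One site, one block, `K′ = 0`, `L = 1`, `h ≡ 1`, `κ₁ = 0`, trivial decoration: the domination holds (both sides are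
the co-owner's explicit quantities; the point is only that the hypotheses are jointly satisfiable). [folklore] -/
example : Dominates (0 : ℝ) (fun w : Walk Unit => (fun (_ : ℕ) (_ : Fin (w.1 + 1) → Unit) => (∅ : Finset Unit)) w.1 w.2)
    (fun w => walkTerm (fun (_ : Unit) (_ : Unit) => (1 : ℝ)) (0 : Matrix Unit Unit ℂ) (fun _ => 1) w.1 w.2)
    (decMaj (Real.exp (0 * 0)) (0 * 0) (fun _ _ => (0 : ℝ)) (fun _ _ => (1 : ℝ)) (0 : Matrix Unit Unit ℂ)
      (fun _ => 1)) :=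
  dominates_decFamily (d := fun _ _ => (0 : ℝ)) (fun _ _ _ => by simp) (fun _ _ => le_rfl) 0 (fun _ _ => 1)
    (fun _ => Finset.univ) (fun _ => 1) (fun _ _ hy => (hy (Finset.mem_univ _)).elim) le_rfl le_rfl
    (fun _ _ => ∅) (fun n b y _ => by
      simp only [Finset.card_empty, Nat.cast_zero, zero_mul, add_zero]
      exact le_rfl)

end

end Summit.QuantumFields.BalabanUV.Beta.AnalyticWalkSum216RowRegroupTube
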